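import Mathlib
import Summits.Ventures.PercRepro.TriangleCapOneTriangleTwoBelowA

/-!
# PercRepro — THE ONE-TRIANGLE CASE TWO BELOW THE DIAGONAL (p3, gen 36; part 49)

`one_triangle_stability_two`: a `K₄⁻`-free graph on `k ≥ 10` vertices with `m ≥ 2k − 3` edges whose every triangle
is `{u, v, w}` has `Σ_v d(v)² + 2 (k − 3) ≤ m·k`.  §10au's far-pair count `Σ deficit ≥ 2(a + b + c) + 6q +
2(ab + bc + ca)` on the partition `a + b + c + q + 3 = k` pays the cell once `q + ab + bc + ca ≥ a + b + c + 3`,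
which holds for `k ≥ 10` except on the two families `(a, 0, 0, q)` and `(0, 1, c, q ≤ 3)` (and their rotations),
paid by `deficit_family_two` / `deficit_family_one` (TriangleCapOneTriangleTwoBelowA) when an outer vertex exists,
and excluded by the sparse exceptions `sparse_of_priv_empty` (§10au) / `sparse_of_priv_one` (§10ay) when none does.
Together with TriangleCapSubDiagonalTriangles (three or more triangles, `k ≥ 12`) this leaves, on the `K₄⁻`-free
class two below the diagonal, exactly the graphs with two triangles (§10az(k′)).
Axioms: standard.
-/

namespace PercRepro

namespace TriangleCap

namespace C047

open Finset

variable {V : Type*} [Fintype V] [DecidableEq V]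

/-- The sub-case of one empty private neighbourhood `priv u = ∅` (after rotation): the far-pair count, the
family `(0, 1, c, q ≤ 3)`, or the sparse exception. -/
theorem one_zero_case (D : SimpleGraph V) [DecidableRel D.Adj] (hK : K4mFree D)
    (hk : 10 ≤ Fintype.card V) {u v w : V} (huv : D.Adj u v) (huw : D.Adj u w) (hvw : D.Adj v w)
    (hT : ∀ a b c, D.Adj a b → D.Adj a c → D.Adj b c → a = u ∨ a = v ∨ a = w)
    (hm : 2 * Fintype.card V ≤ D.edgeFinset.card + 3)
    (hpu : priv D u v w = ∅) (hb : 1 ≤ (priv D v u w).card) (hc : 1 ≤ (priv D w u v).card)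
    (hmain : (priv D v u w).card + (priv D w u v).card + 3 ≤ (outer D u v w).card +
      ((priv D v u w).card * (priv D w u v).card + (priv D u v w).card * (priv D w u v).card +
        (priv D u v w).card * (priv D v u w).card) →
      4 * Fintype.card V ≤ ∑ p ∈ adjPairsAll D, deficit D p + 6) :
    4 * Fintype.card V ≤ ∑ p ∈ adjPairsAll D, deficit D p + 6 := by
  have hvu : D.Adj v u := huv.symm
  have hwu : D.Adj w u := huw.symm
  have hwv : D.Adj w v := hvw.symm
  have hpart := card_partition_triangle D hK huv huw hvw
  rw [hpu, card_empty] at hpart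
  set b := (priv D v u w).card with hb'
  set c := (priv D w u v).card with hc'
  set q := (outer D u v w).card with hq'
  rw [hpu, card_empty] at hmain
  simp only [zero_mul, add_zero] at hmain
  by_cases hbc : 2 ≤ b ∧ 2 ≤ c
  · -- `bc ≥ 2b + 2c − 4` and `b + c + q ≥ 7`
    apply hmain
    obtain ⟨b', hb2⟩ : ∃ b', b = b' + 2 := ⟨b - 2, by omega⟩
    obtain ⟨c', hc2⟩ : ∃ c', c = c' + 2 := ⟨c - 2, by omega⟩
    rw [hb2, hc2]
    nlinarith [Nat.zero_le (b' * c')]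
  by_cases hq4 : 4 ≤ q
  · apply hmain
    have h1 : b ≤ b * c := Nat.le_mul_of_pos_right b hc
    have h2 : c ≤ b * c := Nat.le_mul_of_pos_left c hb
    omega
  by_cases hq0 : q = 0
  · -- no outer vertex: the second sparse exception, `2m ≤ 6 + 2b + 2c + 2bc` with `min(b, c) = 1`
    exfalso
    have hT' : ∀ a b c, D.Adj a b → D.Adj a c → D.Adj b c → a = v ∨ a = w ∨ a = u := by
      intro x y z h1 h2 h3
      rcases hT x y z h1 h2 h3 with h | h | h
      · exact Or.inr (Or.inr h)
      · exact Or.inl h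
      · exact Or.inr (Or.inl h)
    have hQ : outer D v w u = ∅ := by
      rw [outer_comm₂ D v w u]
      exact card_eq_zero.mp hq0
    have hs := sparse_of_priv_one D hK hvw hvu hwu hT' hpu hQ
    rw [priv_comm D v w u, priv_comm D w v u, ← hb', ← hc'] at hs
    have hmin : b = 1 ∨ c = 1 := by omega
    rcases hmin with h1 | h1 <;> rw [h1] at hs hpart <;> omega
  · have hq1 : 1 ≤ q := by omega
    have hmin : b = 1 ∨ c = 1 := by omega
    rcases hmin with h1 | h1
    · exact deficit_family_one D hK huv huw hvw hpu h1 hq1 hm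
    · have hpu' : priv D u w v = ∅ := by rw [priv_comm]; exact hpu
      have hq1' : 1 ≤ (outer D u w v).card := by
        rw [← outer_comm₁ D w u v, ← outer_comm₂ D u v w]; exact hq1
      exact deficit_family_one D hK huw huv hwv hpu' h1 hq1' hm

/-- The sub-case of two empty private neighbourhoods `priv v = priv w = ∅` (after rotation). -/
theorem two_zero_case (D : SimpleGraph V) [DecidableRel D.Adj] (hK : K4mFree D)
    {u v w : V} (huv : D.Adj u v) (huw : D.Adj u w) (hvw : D.Adj v w)
    (hT : ∀ a b c, D.Adj a b → D.Adj a c → D.Adj b c → a = u ∨ a = v ∨ a = w)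
    (hm : 2 * Fintype.card V ≤ D.edgeFinset.card + 3) (hk5 : 5 ≤ Fintype.card V)
    (hpv : priv D v u w = ∅) (hpw : priv D w u v = ∅) :
    4 * Fintype.card V ≤ ∑ p ∈ adjPairsAll D, deficit D p + 6 := by
  by_cases hq : 1 ≤ (outer D u v w).card
  · exact deficit_family_two D hK huv huw hvw hpv hpw hq hm
  · exfalso
    have := sparse_of_priv_empty D hK huv huw hvw hT hpv hpw (by omega) hk5
    omega

/-- **THE ONE-TRIANGLE CASE TWO BELOW THE DIAGONAL** (`k ≥ 10`). -/
theorem one_triangle_stability_two (D : SimpleGraph V) [DecidableRel D.Adj] (hK : K4mFree D)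
    (hk : 10 ≤ Fintype.card V) {u v w : V} (huv : D.Adj u v) (huw : D.Adj u w) (hvw : D.Adj v w)
    (hT : ∀ a b c, D.Adj a b → D.Adj a c → D.Adj b c → a = u ∨ a = v ∨ a = w)
    (hm : 2 * Fintype.card V ≤ D.edgeFinset.card + 3) :
    ∑ v, deg D v * deg D v + 2 * (Fintype.card V - 3) ≤ D.edgeFinset.card * Fintype.card V := by
  have hpart := card_partition_triangle D hK huv huw hvw
  have hvu : D.Adj v u := huv.symm
  have hwu : D.Adj w u := huw.symm
  have hwv : D.Adj w v := hvw.symm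
  -- the pointwise far-pair bound
  have hL : ∀ z, (if z = u then cross D (priv D v u w) (priv D w u v) else 0) +
      (if z = v then cross D (priv D u v w) (priv D w u v) else 0) +
      (if z = w then cross D (priv D u v w) (priv D v u w) else 0) +
      (if z ∈ priv D u v w then 2 + 2 * ((priv D v u w).filter (fun y => ¬ D.Adj z y)).card +
        2 * ((priv D w u v).filter (fun y => ¬ D.Adj z y)).card else 0) +
      (if z ∈ priv D v u w then 2 + 2 * ((priv D u v w).filter (fun y => ¬ D.Adj z y)).card +
        2 * ((priv D w u v).filter (fun y => ¬ D.Adj z y)).card else 0) +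
      (if z ∈ priv D w u v then 2 + 2 * ((priv D u v w).filter (fun y => ¬ D.Adj z y)).card +
        2 * ((priv D v u w).filter (fun y => ¬ D.Adj z y)).card else 0) +
      (if z ∈ outer D u v w then 6 else 0) ≤ far D z := by
    intro z
    rcases classify_triangle D hK huv huw hvw z with rfl | rfl | rfl | hz | hz | hz | hz
    · have h1 : z ∉ priv D z v w := by rw [mem_priv]; exact fun h => h.1.ne rfl
      have h2 : z ∉ priv D v z w := by rw [mem_priv]; exact fun h => h.2.2 hwu
      have h3 : z ∉ priv D w z v := by rw [mem_priv]; exact fun h => h.2.2 hvu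
      have h4 : z ∉ outer D z v w := by rw [mem_outer]; exact fun h => h.2.1 hvu
      simp only [if_true, if_neg huv.ne, if_neg huw.ne, if_neg h1, if_neg h2, if_neg h3, if_neg h4,
        add_zero]
      exact far_ge_cross D z v w
    · have h1 : z ∉ priv D u z w := by rw [mem_priv]; exact fun h => h.2.2 hwv
      have h2 : z ∉ priv D z u w := by rw [mem_priv]; exact fun h => h.1.ne rfl
      have h3 : z ∉ priv D w u z := by rw [mem_priv]; exact fun h => h.2.1 huv
      have h4 : z ∉ outer D u z w := by rw [mem_outer]; exact fun h => h.1 huv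
      simp only [if_true, if_neg huv.ne.symm, if_neg hvw.ne, if_neg h1, if_neg h2, if_neg h3, if_neg h4,
        add_zero, zero_add]
      have := far_ge_cross D z u w
      rw [priv_comm D w z u] at this
      exact this
    · have h1 : z ∉ priv D u v z := by rw [mem_priv]; exact fun h => h.2.1 hvw
      have h2 : z ∉ priv D v u z := by rw [mem_priv]; exact fun h => h.2.1 huw
      have h3 : z ∉ priv D z u v := by rw [mem_priv]; exact fun h => h.1.ne rfl
      have h4 : z ∉ outer D u v z := by rw [mem_outer]; exact fun h => h.1 huw
      simp only [if_true, if_neg huw.ne.symm, if_neg hvw.ne.symm, if_neg h1, if_neg h2, if_neg h3,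
        if_neg h4, add_zero, zero_add]
      have := far_ge_cross D z u v
      rw [priv_comm D u z v, priv_comm D v z u] at this
      exact this
    · have hz' := (mem_priv D u v w z).mp hz
      have hzu : z ≠ u := fun h => hz'.1.ne h.symm
      have hzv : z ≠ v := fun h => hz'.2.2 (h ▸ hwv)
      have hzw : z ≠ w := fun h => hz'.2.1 (h ▸ hvw)
      have h2 : z ∉ priv D v u w := by rw [mem_priv]; exact fun h => hz'.2.1 h.1
      have h3 : z ∉ priv D w u v := by rw [mem_priv]; exact fun h => hz'.2.2 h.1
      have h4 : z ∉ outer D u v w := by rw [mem_outer]; exact fun h => h.1 hz'.1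
      simp only [if_neg hzu, if_neg hzv, if_neg hzw, if_pos hz, if_neg h2, if_neg h3, if_neg h4,
        add_zero, zero_add]
      exact far_ge_of_mem_priv D huv huw hvw hz
    · have hz' := (mem_priv D v u w z).mp hz
      have hzu : z ≠ u := fun h => hz'.2.2 (h ▸ hwu)
      have hzv : z ≠ v := fun h => hz'.1.ne h.symm
      have hzw : z ≠ w := fun h => hz'.2.1 (h ▸ huw)
      have h1 : z ∉ priv D u v w := by rw [mem_priv]; exact fun h => hz'.2.1 h.1
      have h3 : z ∉ priv D w u v := by rw [mem_priv]; exact fun h => hz'.2.2 h.1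
      have h4 : z ∉ outer D u v w := by rw [mem_outer]; exact fun h => h.2.1 hz'.1
      simp only [if_neg hzu, if_neg hzv, if_neg hzw, if_neg h1, if_pos hz, if_neg h3, if_neg h4,
        add_zero, zero_add]
      have := far_ge_of_mem_priv D hvu hvw huw hz
      rw [priv_comm D w v u] at this
      exact this
    · have hz' := (mem_priv D w u v z).mp hz
      have hzu : z ≠ u := fun h => hz'.2.2 (h ▸ hvu)
      have hzv : z ≠ v := fun h => hz'.2.1 (h ▸ huv)
      have hzw : z ≠ w := fun h => hz'.1.ne h.symm
      have h1 : z ∉ priv D u v w := by rw [mem_priv]; exact fun h => hz'.2.1 h.1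
      have h2 : z ∉ priv D v u w := by rw [mem_priv]; exact fun h => hz'.2.2 h.1
      have h4 : z ∉ outer D u v w := by rw [mem_outer]; exact fun h => h.2.2 hz'.1
      simp only [if_neg hzu, if_neg hzv, if_neg hzw, if_neg h1, if_neg h2, if_pos hz, if_neg h4,
        add_zero, zero_add]
      have := far_ge_of_mem_priv D hwu hwv huv hz
      rw [priv_comm D u w v, priv_comm D v w u] at this
      exact this
    · have hz' := (mem_outer D u v w z).mp hz
      have hzu : z ≠ u := fun h => hz'.2.1 (h ▸ hvu)
      have hzv : z ≠ v := fun h => hz'.1 (h ▸ huv)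
      have hzw : z ≠ w := fun h => hz'.1 (h ▸ huw)
      have h1 : z ∉ priv D u v w := by rw [mem_priv]; exact fun h => hz'.1 h.1
      have h2 : z ∉ priv D v u w := by rw [mem_priv]; exact fun h => hz'.2.1 h.1
      have h3 : z ∉ priv D w u v := by rw [mem_priv]; exact fun h => hz'.2.2 h.1
      simp only [if_neg hzu, if_neg hzv, if_neg hzw, if_neg h1, if_neg h2, if_neg h3, if_pos hz,
        zero_add]
      exact far_ge_six_of_mem_outer D huv huw hvw hz
  have hsum := sum_le_sum (fun z (_ : z ∈ univ) => hL z)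
  rw [← sum_deficit_eq_sum_far] at hsum
  simp only [sum_add_distrib, sum_ite_eq', mem_univ, if_true, sum_ite_mem, univ_inter, sum_const,
    smul_eq_mul, ← mul_sum] at hsum
  -- the cross-pair counts
  have d1 : Disjoint (priv D v u w) (priv D w u v) := by
    rw [disjoint_left]; intro y h1 h2; rw [mem_priv] at h1 h2; exact h2.2.2 h1.1
  have d2 : Disjoint (priv D u v w) (priv D w u v) := by
    rw [disjoint_left]; intro y h1 h2; rw [mem_priv] at h1 h2; exact h2.2.1 h1.1
  have d3 : Disjoint (priv D u v w) (priv D v u w) := by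
    rw [disjoint_left]; intro y h1 h2; rw [mem_priv] at h1 h2; exact h2.2.1 h1.1
  have c1 := cross_add_sum_ge D _ _ d1
  have c2 := cross_add_sum_ge D _ _ d2
  have c3 := cross_add_sum_ge D _ _ d3
  have hid := two_mul_sum_deg_sq_add_sum_deficit D
  have hT6 := card_triangles3_le_six D hT
  -- names
  set a := (priv D u v w).card with ha
  set b := (priv D v u w).card with hb
  set c := (priv D w u v).card with hc
  set q := (outer D u v w).card with hq
  have hF : 2 * a + 2 * b + 2 * c + 6 * q + 2 * (b * c) + 2 * (a * c) + 2 * (a * b) ≤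
      ∑ p ∈ adjPairsAll D, deficit D p := by omega
  -- the cell follows from `4k ≤ Σ deficit + 6`
  have hmk : 2 * (D.edgeFinset.card * Fintype.card V) = 2 * D.edgeFinset.card * Fintype.card V := by ring
  suffices hkey : 4 * Fintype.card V ≤ ∑ p ∈ adjPairsAll D, deficit D p + 6 by omega
  -- the main case: `q + ab + bc + ca ≥ a + b + c + 3`
  have main : a + b + c + 3 ≤ q + (b * c + a * c + a * b) →
      4 * Fintype.card V ≤ ∑ p ∈ adjPairsAll D, deficit D p + 6 := by
    intro h
    omega
  have hk5 : 5 ≤ Fintype.card V := by omega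
  by_cases habc : 1 ≤ a ∧ 1 ≤ b ∧ 1 ≤ c
  · apply main
    have h1 := mul_ge_add_sub_one a b habc.1 habc.2.1
    have h2 := mul_ge_add_sub_one b c habc.2.1 habc.2.2
    have h3 := mul_ge_add_sub_one a c habc.1 habc.2.2
    omega
  -- some private neighbourhood is empty
  by_cases ha0 : a = 0
  · have hpu : priv D u v w = ∅ := card_eq_zero.mp ha0
    by_cases hb0 : b = 0
    · have hpv : priv D v u w = ∅ := card_eq_zero.mp hb0
      by_cases hc0 : c = 0
      · -- all three empty: `q = k − 3 ≥ 7`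
        apply main
        omega
      · -- `(0, 0, c)`: the family at `w`
        have hT' : ∀ x y z, D.Adj x y → D.Adj x z → D.Adj y z → x = w ∨ x = u ∨ x = v := by
          intro x y z h1 h2 h3
          rcases hT x y z h1 h2 h3 with h | h | h
          · exact Or.inr (Or.inl h)
          · exact Or.inr (Or.inr h)
          · exact Or.inl h
        have hpu' : priv D u w v = ∅ := by rw [priv_comm]; exact hpu
        have hpv' : priv D v w u = ∅ := by rw [priv_comm]; exact hpv
        exact two_zero_case D hK hwu hwv huv hT' hm hk5 hpu' hpv'
    · by_cases hc0 : c = 0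
      · -- `(0, b, 0)`: the family at `v`
        have hpw : priv D w u v = ∅ := card_eq_zero.mp hc0
        have hT' : ∀ x y z, D.Adj x y → D.Adj x z → D.Adj y z → x = v ∨ x = u ∨ x = w := by
          intro x y z h1 h2 h3
          rcases hT x y z h1 h2 h3 with h | h | h
          · exact Or.inr (Or.inl h)
          · exact Or.inl h
          · exact Or.inr (Or.inr h)
        have hpw' : priv D w v u = ∅ := by rw [priv_comm]; exact hpw
        exact two_zero_case D hK hvu hvw huw hT' hm hk5 hpu hpw'
      · -- `(0, b, c)` with `b, c ≥ 1`
        refine one_zero_case D hK hk huv huw hvw hT hm hpu (by omega) (by omega) ?_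
        intro h
        rw [← ha, ← hb, ← hc, ← hq] at h
        apply main
        omega
  · by_cases hb0 : b = 0
    · have hpv : priv D v u w = ∅ := card_eq_zero.mp hb0
      by_cases hc0 : c = 0
      · have hpw : priv D w u v = ∅ := card_eq_zero.mp hc0
        exact two_zero_case D hK huv huw hvw hT hm hk5 hpv hpw
      · -- `(a, 0, c)` with `a, c ≥ 1`: rotate to `(v, u, w)`
        have hT' : ∀ x y z, D.Adj x y → D.Adj x z → D.Adj y z → x = v ∨ x = u ∨ x = w := by
          intro x y z h1 h2 h3
          rcases hT x y z h1 h2 h3 with h | h | h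
          · exact Or.inr (Or.inl h)
          · exact Or.inl h
          · exact Or.inr (Or.inr h)
        have hpw' : priv D w v u = priv D w u v := priv_comm D w v u
        have hout : outer D v u w = outer D u v w := (outer_comm₁ D u v w).symm
        refine one_zero_case D hK hk hvu hvw huw hT' hm hpv (by omega) (by rw [hpw']; omega) ?_
        intro h
        rw [hpw', hout, ← ha, ← hb, ← hc, ← hq] at h
        have cab : b * a = a * b := Nat.mul_comm b a
        apply main
        omega
    · -- `(a, b, 0)` with `a, b ≥ 1`: rotate to `(w, u, v)`
      have hc0 : c = 0 := by omega
      have hpw : priv D w u v = ∅ := card_eq_zero.mp hc0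
      have hT' : ∀ x y z, D.Adj x y → D.Adj x z → D.Adj y z → x = w ∨ x = u ∨ x = v := by
        intro x y z h1 h2 h3
        rcases hT x y z h1 h2 h3 with h | h | h
        · exact Or.inr (Or.inl h)
        · exact Or.inr (Or.inr h)
        · exact Or.inl h
      have hpu' : priv D u w v = priv D u v w := priv_comm D u w v
      have hpv' : priv D v w u = priv D v u w := priv_comm D v w u
      have hout : outer D w u v = outer D u v w := (outer_comm₂ D u v w).symm
      refine one_zero_case D hK hk hwu hwv huv hT' hm hpw (by rw [hpu']; omega) (by rw [hpv']; omega) ?_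
      intro h
      rw [hpu', hpv', hout, ← ha, ← hb, ← hc, ← hq] at h
      have ccb : c * b = b * c := Nat.mul_comm c b
      have cca : c * a = a * c := Nat.mul_comm c a
      apply main
      omega

end C047

end TriangleCap

end PercRepro
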